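import Mathlib
import Summits.Ventures.PercRepro.TriangleCapZoneArith

/-!
# PercRepro — TOOLS FOR THE ZONE BELOW THE THRESHOLD: THE COLUMN LOSS AT ANY RESIDUE, THE COST OF SEVERAL PARTIAL
VALUES (p3, gen 56; part 328)

For the narrow regime `2 r ≤ D < 4 r − 2` one below the threshold (and the zone in general) the `I ≠ r` cases need
the column-loss lemma of part 325 at the residue `σ = r + I` instead of `2 r`: values `c ≤ D` with `Σ c ≡ σ (mod D)`,
`1 ≤ σ ≤ D − 1`, and two distinguished members `1 ≤ c(x), c(x')` with `c(x) + c(x') ≤ D + σ − 1` have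
`Σ c (D − c) ≥ φ_D(σ) + 2 σ − 2` (`column_loss_sigma`; the same three cases, the constant `2 D − 2 σ ≥ 2` in the
high case).  And several partial values are expensive: values `1 ≤ c_i ≤ D − 1` with `Σ c_i = S ≤ D` have
`Σ c_i (D − c_i) = φ_D(S) + 2 e₂(c)` and `e₂ ≥ S − 1` as soon as there are two of them (`sum_partial_ge_phi_add`:
`φ_D(S) + 2 (S − 1) ≤ Σ c_i (D − c_i)`).  Axioms: standard.
-/

namespace PercRepro

namespace TriangleCap

namespace C047

open Finset

/-- `φ_D(a) = a (D − a)` for `a ≤ D` (at `a = D` both sides vanish). -/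
theorem phiD_of_le (D a : ℕ) (h : a ≤ D) : phiD D a = a * (D - a) := by
  rcases Nat.lt_or_ge a D with hlt | hge
  · exact phiD_of_lt D a hlt
  · have : a = D := by omega
    subst this
    rw [phiD_self, Nat.sub_self, mul_zero]

/-- One end full at the residue `σ`: `v' ≤ σ − 1`, the rest `≡ σ − v'`; surplus `2 (v' − 1)(σ − 1 − v')`. -/
theorem column_loss_sigma_full (D σ v' : ℕ) (hσ : σ + 1 ≤ D) (hv' : 1 ≤ v') (hv2 : v' + 1 ≤ σ) :
    phiD D σ + (2 * σ - 2) ≤ v' * (D - v') + (σ - v') * (D - (σ - v')) := by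
  rw [phiD_of_lt D σ (by omega)]
  obtain ⟨u, rfl⟩ : ∃ u, D = σ + u := ⟨D - σ, by omega⟩
  obtain ⟨a, rfl⟩ : ∃ a, v' = a + 1 := ⟨v' - 1, by omega⟩
  obtain ⟨c, rfl⟩ : ∃ c, σ = a + c + 2 := ⟨σ - a - 2, by omega⟩
  have e0 : 2 * (a + c + 2) - 2 = 2 * (a + c) + 2 := by omega
  have e1 : a + c + 2 + u - (a + c + 2) = u := by omega
  have e2 : a + c + 2 + u - (a + 1) = c + 1 + u := by omega
  have e3 : a + c + 2 - (a + 1) = c + 1 := by omega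
  have e4 : a + c + 2 + u - (c + 1) = a + 1 + u := by omega
  rw [e0, e1, e2, e3, e4]
  nlinarith [Nat.zero_le (a * c)]

/-- Both ends partial with `v + v' ≤ σ` at the residue `σ`. -/
theorem column_loss_sigma_low (D σ v v' : ℕ) (hσ : σ + 1 ≤ D) (hv : 1 ≤ v) (hv' : 1 ≤ v') (hs : v + v' ≤ σ) :
    phiD D σ + (2 * σ - 2) ≤ v * (D - v) + v' * (D - v') + (σ - (v + v')) * (D - (σ - (v + v'))) := by
  rw [phiD_of_lt D σ (by omega)]
  obtain ⟨u, rfl⟩ : ∃ u, D = σ + u := ⟨D - σ, by omega⟩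
  obtain ⟨a, rfl⟩ : ∃ a, v = a + 1 := ⟨v - 1, by omega⟩
  obtain ⟨b, rfl⟩ : ∃ b, v' = b + 1 := ⟨v' - 1, by omega⟩
  obtain ⟨c, rfl⟩ : ∃ c, σ = a + b + 2 + c := ⟨σ - a - b - 2, by omega⟩
  have e0 : 2 * (a + b + 2 + c) - 2 = 2 * (a + b + c) + 2 := by omega
  have e1 : a + b + 2 + c + u - (a + b + 2 + c) = u := by omega
  have e2 : a + b + 2 + c + u - (a + 1) = b + c + 1 + u := by omega
  have e3 : a + b + 2 + c + u - (b + 1) = a + c + 1 + u := by omega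
  have e4 : a + b + 2 + c - (a + 1 + (b + 1)) = c := by omega
  have e5 : a + b + 2 + c + u - c = a + b + 2 + u := by omega
  rw [e0, e1, e2, e3, e4, e5]
  nlinarith [Nat.zero_le (a * b), Nat.zero_le (c * (a + b + 1))]

/-- Both ends partial with `v + v' > σ` at the residue `σ`, in `a = D − v`, `a' = D − v'`. -/
theorem column_loss_sigma_high (D σ a a' : ℕ) (hσ1 : 1 ≤ σ) (hσ : σ + 1 ≤ D) (ha : 1 ≤ a) (haD : a + 1 ≤ D)
    (ha' : 1 ≤ a') (ha'D : a' + 1 ≤ D) (hs1 : D + 1 ≤ a + a' + σ) (hs2 : a + a' + σ + 1 ≤ 2 * D) :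
    phiD D σ + (2 * σ - 2) ≤ (D - a) * a + (D - a') * a' + (a + a' + σ - D) * (2 * D - σ - (a + a')) := by
  rw [phiD_of_lt D σ (by omega)]
  rcases Nat.lt_or_ge (a + a') (D + 1) with hu | hu
  · have hk1 : 0 ≤ ((a : ℤ) - 1) * ((a' : ℤ) - 1) := by
      apply mul_nonneg <;> omega
    have hk2 : 0 ≤ ((a : ℤ) + a' + σ - D - 1) * ((D : ℤ) - (a + a')) := by
      apply mul_nonneg <;> omega
    zify [(by omega : a ≤ D), (by omega : a' ≤ D), (by omega : D ≤ a + a' + σ), (by omega : σ ≤ D),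
      (by omega : 2 ≤ 2 * σ), (by omega : a + a' ≤ 2 * D - σ), (by omega : σ ≤ 2 * D)] at hk1 hk2 ⊢
    nlinarith [hk1, hk2]
  · have hk1 : 0 ≤ ((D : ℤ) - 1 - a) * ((D : ℤ) - 1 - a') := by
      apply mul_nonneg <;> omega
    have hk2 : 0 ≤ ((a : ℤ) + a' - D) * (2 * (D : ℤ) - σ - 1 - (a + a')) := by
      apply mul_nonneg <;> omega
    zify [(by omega : a ≤ D), (by omega : a' ≤ D), (by omega : D ≤ a + a' + σ), (by omega : σ ≤ D),
      (by omega : 2 ≤ 2 * σ), (by omega : a + a' ≤ 2 * D - σ), (by omega : σ ≤ 2 * D)] at hk1 hk2 ⊢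
    nlinarith [hk1, hk2]

/-- **THE COLUMN LOSS AT ANY RESIDUE, CORE:** `1 ≤ σ ≤ D − 1`, `1 ≤ v, v' ≤ D`, `v + v' ≤ D + σ − 1`,
`(v + v' + R) mod D = σ`: `φ_D(σ) + (2 σ − 2) ≤ v (D − v) + v' (D − v') + φ_D(R)`. -/
theorem column_loss_sigma_core (D σ v v' R : ℕ) (hσ1 : 1 ≤ σ) (hσ : σ + 1 ≤ D) (hv : 1 ≤ v) (hvD : v ≤ D)
    (hv' : 1 ≤ v') (hv'D : v' ≤ D) (hb : v + v' ≤ D + σ - 1) (hR : (v + v' + R) % D = σ) :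
    phiD D σ + (2 * σ - 2) ≤ v * (D - v) + v' * (D - v') + phiD D R := by
  have hD : 0 < D := by omega
  rw [phiD_mod D R, phiD_of_lt D σ (by omega)]
  have hρ : R % D < D := Nat.mod_lt R hD
  have hvv := mod_three_cases (v + v' + R % D) D (by omega)
  rw [Nat.add_mod_mod, hR] at hvv
  unfold phiD
  rw [Nat.mod_mod]
  rcases Nat.lt_or_ge v D with hvlt | hvge
  · rcases Nat.lt_or_ge v' D with hv'lt | hv'ge
    · rcases Nat.lt_or_ge (v + v') (σ + 1) with hs | hs
      · have hρv : R % D = σ - (v + v') := by omega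
        rw [hρv]
        have := column_loss_sigma_low D σ v v' hσ hv hv' (by omega)
        rw [phiD_of_lt D σ (by omega)] at this
        exact this
      · have hρv : R % D = D + σ - (v + v') := by omega
        rw [hρv]
        obtain ⟨a, ha⟩ : ∃ a, v = D - a := ⟨D - v, by omega⟩
        obtain ⟨a', ha'⟩ : ∃ a', v' = D - a' := ⟨D - v', by omega⟩
        have haD : a + 1 ≤ D := by omega
        have ha'D : a' + 1 ≤ D := by omega
        have ha1 : 1 ≤ a := by omega
        have ha1' : 1 ≤ a' := by omega
        subst ha ha'
        have e1 : D - (D - a) = a := by omega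
        have e2 : D - (D - a') = a' := by omega
        have e3 : D + σ - (D - a + (D - a')) = a + a' + σ - D := by omega
        have e4 : D - (a + a' + σ - D) = 2 * D - σ - (a + a') := by omega
        rw [e1, e2, e3, e4]
        have := column_loss_sigma_high D σ a a' hσ1 hσ ha1 haD ha1' ha'D (by omega) (by omega)
        rw [phiD_of_lt D σ (by omega)] at this
        exact this
    · have hv'D' : v' = D := by omega
      have hρv : R % D = σ - v := by omega
      rw [hv'D', hρv, Nat.sub_self, mul_zero, add_zero]
      have := column_loss_sigma_full D σ v hσ hv (by omega)
      rw [phiD_of_lt D σ (by omega)] at this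
      exact this
  · have hvD' : v = D := by omega
    have hρv : R % D = σ - v' := by omega
    rw [hvD', hρv, Nat.sub_self, mul_zero, zero_add]
    have := column_loss_sigma_full D σ v' hσ hv' (by omega)
    rw [phiD_of_lt D σ (by omega)] at this
    exact this

/-- **THE COLUMN LOSS AT ANY RESIDUE:** values `c ≤ D` on `s` with `Σ c ≡ σ (mod D)`, `1 ≤ σ ≤ D − 1`, two
distinguished members `x ≠ x'` with `1 ≤ c(x), c(x')` and `c(x) + c(x') ≤ D + σ − 1`:
`φ_D(σ) + (2 σ − 2) ≤ Σ c (D − c)`. -/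
theorem column_loss_sigma {ι : Type*} [DecidableEq ι] (s : Finset ι) (c : ι → ℕ) (D σ : ℕ) (hσ1 : 1 ≤ σ)
    (hσ : σ + 1 ≤ D) (hc : ∀ i ∈ s, c i ≤ D) (x x' : ι) (hx : x ∈ s) (hx' : x' ∈ s) (hne : x ≠ x')
    (h1 : 1 ≤ c x) (h1' : 1 ≤ c x') (hb : c x + c x' ≤ D + σ - 1) (hsum : (∑ i ∈ s, c i) % D = σ) :
    phiD D σ + (2 * σ - 2) ≤ ∑ i ∈ s, c i * (D - c i) := by
  have hx'' : x' ∈ s.erase x := mem_erase.mpr ⟨hne.symm, hx'⟩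
  rw [← sum_erase_add s _ hx, ← sum_erase_add (s.erase x) _ hx''] at hsum
  rw [← sum_erase_add s (fun i => c i * (D - c i)) hx, ← sum_erase_add (s.erase x) (fun i => c i * (D - c i)) hx'']
  have hrest := sum_mul_sub_ge_phi ((s.erase x).erase x') c D
    (fun i hi => hc i (mem_of_mem_erase (mem_of_mem_erase hi)))
  have hcore := column_loss_sigma_core D σ (c x) (c x') (∑ i ∈ (s.erase x).erase x', c i) hσ1 hσ h1 (hc x hx) h1'
    (hc x' hx') hb (by rw [← hsum]; congr 1; ring)
  omega

/-- **SEVERAL PARTIAL VALUES:** values `1 ≤ c_i ≤ D − 1` on `s` (`|s| ≥ 2`) with `Σ c_i = S ≤ D` have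
`φ_D(S) + 2 (S − 1) ≤ Σ c_i (D − c_i)` — the surplus over `φ_D(S)` is `2 e₂(c) ≥ 2 (S − 1)`. -/
theorem sum_partial_ge_phi_add {ι : Type*} [DecidableEq ι] (s : Finset ι) (c : ι → ℕ) (D : ℕ)
    (hc1 : ∀ i ∈ s, 1 ≤ c i) (hcD : ∀ i ∈ s, c i + 1 ≤ D) (hS : ∑ i ∈ s, c i ≤ D) (hcard : 2 ≤ s.card) :
    phiD D (∑ i ∈ s, c i) + 2 * (∑ i ∈ s, c i - 1) ≤ ∑ i ∈ s, c i * (D - c i) := by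
  obtain ⟨x, hx, x', hx', hne⟩ := one_lt_card.mp hcard
  have hx'' : x' ∈ s.erase x := mem_erase.mpr ⟨hne.symm, hx'⟩
  rw [← sum_erase_add s _ hx, ← sum_erase_add (s.erase x) _ hx''] at hS ⊢
  rw [← sum_erase_add s (fun i => c i * (D - c i)) hx, ← sum_erase_add (s.erase x) (fun i => c i * (D - c i)) hx'']
  have hrest := sum_mul_sub_ge_phi ((s.erase x).erase x') c D
    (fun i hi => by have := hcD i (mem_of_mem_erase (mem_of_mem_erase hi)); omega)
  have hpair := phi_pair_add_two D (c x') (c x) (hc1 x' hx') (by have := hcD x' hx'; omega) (hc1 x hx)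
    (by have := hcD x hx; omega)
  -- sharpen the pair: `v (D − v) + v' (D − v') = φ_D(v + v') + 2 v v'` for `v + v' ≤ D`, and `v v' ≥ v + v' − 1`
  obtain ⟨Rst, hRst⟩ : ∃ Rst, ∑ i ∈ (s.erase x).erase x', c i = Rst := ⟨_, rfl⟩
  rw [hRst] at hS hrest ⊢
  have e : Rst + c x' + c x = Rst + (c x' + c x) := by ring
  rw [e]
  have hx1 := hc1 x hx
  have hx1' := hc1 x' hx'
  have hxD := hcD x hx
  have hxD' := hcD x' hx'
  -- `φ_D(v + v') + 2 v v' = v (D − v) + v' (D − v')` for `v + v' ≤ D`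
  have hpair' : phiD D (c x' + c x) + 2 * (c x' * c x) = c x' * (D - c x') + c x * (D - c x) := by
    rw [phiD_of_le D _ (by omega)]
    obtain ⟨u, hu⟩ : ∃ u, D = c x' + c x + u := ⟨D - c x' - c x, by omega⟩
    rw [hu]
    have e1 : c x' + c x + u - (c x' + c x) = u := by omega
    have e2 : c x' + c x + u - c x' = c x + u := by omega
    have e3 : c x' + c x + u - c x = c x' + u := by omega
    rw [e1, e2, e3]
    ring
  have hvv : c x' + c x - 1 ≤ c x' * c x := by
    obtain ⟨a, ha⟩ : ∃ a, c x = a + 1 := ⟨c x - 1, by omega⟩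
    obtain ⟨b, hb⟩ : ∃ b, c x' = b + 1 := ⟨c x' - 1, by omega⟩
    rw [ha, hb]
    have e : (b + 1) * (a + 1) = b * a + b + a + 1 := by ring
    rw [e]
    omega
  -- the cross term: `φ_D(Rst) + φ_D(S') − φ_D(Rst + S') = 2 Rst S'` (`Rst + S' ≤ D`)
  have hcross : phiD D (Rst + (c x' + c x)) + 2 * (Rst * (c x' + c x)) = phiD D Rst + phiD D (c x' + c x) := by
    rw [phiD_of_le D _ (by omega), phiD_of_le D Rst (by omega), phiD_of_le D _ (by omega)]
    obtain ⟨u, hu⟩ : ∃ u, D = Rst + (c x' + c x) + u := ⟨D - Rst - (c x' + c x), by omega⟩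
    rw [hu]
    have e1 : Rst + (c x' + c x) + u - (Rst + (c x' + c x)) = u := by omega
    have e2 : Rst + (c x' + c x) + u - Rst = c x' + c x + u := by omega
    have e3 : Rst + (c x' + c x) + u - (c x' + c x) = Rst + u := by omega
    rw [e1, e2, e3]
    ring
  have hRS : Rst ≤ Rst * (c x' + c x) := Nat.le_mul_of_pos_right Rst (by omega)
  omega

end C047

end TriangleCap

end PercRepro
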